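/-
Copyright: statement-level skeleton of a published paper (lit-balaban cell, Phase-2 proof seat p25, gen 16). No proof
claims beyond what the kernel checks below.
-/
import Literature.MathematicalPhysics.QuantumFieldTheory.BalabanImbrieJaffe1984to88.BIJ88LabelledExpansion311

/-!
# `BalabanImbrieJaffe1984to88.BIJ88LabelledRemainderCount312` — T. Bałaban, J. Imbrie, A. Jaffe, *Effective action
and cluster properties of the abelian Higgs model*, Commun. Math. Phys. **114** (1988) 257–315
[BalabanImbrieJaffe1988], §5.14 p. 311 [PDF 55] *"A connected component of X is called complete if a contraction to
χ′_{Λ^{(k)}} occurs, if a term from the random walk expansion occurs, if at least m̄ + 1 interactions have been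
differentiated down, or if the term is constant (all legs contracted). … The components containing contractions to
χ′_{Λ^{(k)}}, terms from the random walk expansions, or at least m̄ + 1 interactions are called remainder components
{X_r}. The other components are called constant components {X_c}, since the observable there is independent of
A^{(k)}, φ^{(k)}."* — **EVERY REMAINDER COMPONENT OF EVERY TERM OF THE LABELLED
EXPANSION CARRIES ITS OWN SMALL-FACTOR SOURCE, COUNTED**: in the labelled component expansion `expand` of
`BIJ88LabelledExpansion311` (whose resummation `Σ_O CST(K∖O)·REM(O)` is `BIJ88Resummation312`), every set-aside
component `X_r` of a term from nothing set aside is a REMAINDER component — at least one contraction to `χ′` of its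
own (`0 < nchi`) or at least `M = m̄+1` vertices of its own (`M ≤ nv`) — and the `χ′`-directions and vertices of a
term are the sums of those of its components; hence `#{X_r with a χ′} ≤ |dirs t|`, `M · #{X_r vertex-saturated} ≤ nv t`
and `#X_r ≤` their sum.  This is the COUNTING half of "each remainder component carries a small factor", per
component, in the currency of the resummed display; the analytic half (a `χ′` under the integral is small on the
shell; `M` vertices give `c_M^M`) is gen 15's `BIJ88VertexComponentsFieldLaw312` / `BIJ88VertexChiShell312` for the
unlabelled expansion and is NOT transported here (no coefficient bound for `expand` is proved in this file).

statement-level skeleton of published theorems with citation tags; proofs where landed; nothing here is a claim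
about the Yang–Mills mass gap

PDF held: `paper:balaban1988-cmp114-bij-abelian-higgs-effective-action` (journal page = PDF page + 256); p. 311–312 =
PDF 55–56 (`p0055.txt` L30–38, `p0056.txt` L1–4 re-read this session; both quoted sentences are p0055 L30–33 /
L36–38 verbatim).

CITATION HEADER (lean-in-tree rule).  lit-balaban cell (HOME `run/shared/lean/pub/lit-balaban/`), Phase 2, seat p25
gen 16; row **C2.Claim@312** of `HOME/lit-balaban-r16/ROWS-C2-part2.md` (owner r16, referee ref-5; head untouched —
a member next to `BIJ88Resummation312(Display)`).  USED BY NAME, nothing restated: `BIJ88LabelledRun311`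
(`run`, `Outcome`, `LGrp.absorb`, `pristine`), `BIJ88LabelledRunEnv311` (`run_ind'`, `run_rest_subset`, `run_done_le`,
`run_complete`), `BIJ88LabelledExpansion311` (`expand`, `RTerm`, `oact`), `BIJ88VertexComponents311`
(`Grp.complete/IsConst/IsRem`, `Grp.isConst_or_isRem_of_complete`).

## What is proved (0 `sorry`, standard axioms, no definitions, no `Prop` facts)

* §1 **`run_nchi`**, **`run_nv`** — along a run the `χ′`-count and the vertex count of (running component +
  set-aside components) grow exactly by the directions `o.D` and the vertices `o.dv` the run produced.
* §2 **`expand_nchi`**, **`expand_nv`** — for every term, `Σ_{components} nchi = Σ_{done} nchi + |dirs t|` and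
  `Σ_{components} nv = Σ_{done} nv + nv t`; **`expand_groups_isRem`** — every set-aside component of a term is a
  remainder component (given that those passed in are).
* §3 **`remainder_components_count`** — for `t ∈ expand 0 K`: every `X_r ∈ t.groups` is a remainder component;
  `#(X_r with 0 < nchi) ≤ |t.dirs|`; `M · #(X_r with M ≤ nv) ≤ t.nv`; `#t.groups ≤ #(…nchi) + #(…nv)`.
HONEST SCOPE: counting only; contraction-graph components (as in the siblings); no coefficient or integral bound for
the labelled expansion.  CURRENCY: feeds none of `BIJ88Sect5StatementsPart4.Ineq312` / `hobs` by name.  NOT summit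
progress; NOT continuum; NOT Clay.  Imports `BIJ88LabelledExpansion311` only; modifies nothing.
-/

noncomputable section

namespace Literature.MathematicalPhysics.QuantumFieldTheory.BalabanImbrieJaffe1984to88.BIJ88LabelledRemainderCount312

open Classical Matrix Finset
open scoped BigOperators
open BIJ88VertexComponents311 (Grp)
open BIJ88LabelledRun311 BIJ88LabelledRunEnv311 BIJ88LabelledExpansion311

variable {S : Type} [Fintype S] [DecidableEq S] {ι : Type} [Fintype ι] {κ : Type} [LinearOrder κ]
variable (A : Matrix S S ℝ) (f : S → ℝ) (c : ι → ℝ) (legs : ι → List (S → ℝ)) (obs : κ → List (S → ℝ)) (M : ℕ)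

/-! ## §1  Conservation of the `χ′`- and vertex counts along a run -/

/-- **A run's contractions to `χ′` are booked in the components**: the `χ′`-count of the running component plus
those of the set-aside components grows exactly by the number of directions the run produced.
[cite: BalabanImbrieJaffe1988, §5.14 p.311] -/
theorem run_nchi (g : LGrp S κ) (rest : Finset κ) (done : Multiset (LGrp S κ)) :
    ∀ o ∈ run A f c legs obs M g rest done,
      o.g.nchi + (o.done.map fun h => h.nchi).sum = g.nchi + (done.map fun h => h.nchi).sum + o.D.length := by
  refine run_ind' (P := fun g _ done o =>
      o.g.nchi + (o.done.map fun h => h.nchi).sum = g.nchi + (done.map fun h => h.nchi).sum + o.D.length)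
    (fun _ _ _ _ => rfl) ?_ ?_ ?_ ?_ ?_ ?_ g rest done
  · intro g rest done u L _ _ i o _ h
    rw [Outcome.scale_g, Outcome.scale_done, Outcome.scale_D]; exact h
  · intro g rest done u L _ _ j _ i o _ h
    rw [Outcome.scale_g, Outcome.scale_done, Outcome.scale_D]; exact h
  · intro g rest done u L _ _ h hh i _ o _ h'
    rw [Outcome.scale_g, Outcome.scale_done, Outcome.scale_D, h']
    conv_rhs => rw [← Multiset.cons_erase hh, Multiset.map_cons, Multiset.sum_cons]
    simp only [LGrp.absorb]
    ring
  · intro g rest done u L _ _ o _ h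
    rw [Outcome.scale_g, Outcome.scale_done, Outcome.scale_D]; exact h
  · intro g rest done u L _ _ o _ h
    rw [Outcome.push_g, Outcome.push_done, Outcome.push_D, List.length_cons, h]
    simp only
    ring
  · intro g rest done u L _ _ m j o _ h
    rw [Outcome.bump_g, Outcome.bump_done, Outcome.bump_D, Outcome.scale_g, Outcome.scale_done, Outcome.scale_D]
    exact h

/-- **A run's vertices are booked in the components**: the vertex count of the running component plus those of the
set-aside components grows exactly by the number of vertices the run differentiated down.
[cite: BalabanImbrieJaffe1988, §5.14 p.311] -/
theorem run_nv (g : LGrp S κ) (rest : Finset κ) (done : Multiset (LGrp S κ)) :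
    ∀ o ∈ run A f c legs obs M g rest done,
      o.g.nv + (o.done.map fun h => h.nv).sum = g.nv + (done.map fun h => h.nv).sum + o.dv := by
  refine run_ind' (P := fun g _ done o =>
      o.g.nv + (o.done.map fun h => h.nv).sum = g.nv + (done.map fun h => h.nv).sum + o.dv)
    (fun _ _ _ _ => rfl) ?_ ?_ ?_ ?_ ?_ ?_ g rest done
  · intro g rest done u L _ _ i o _ h
    rw [Outcome.scale_g, Outcome.scale_done, Outcome.scale_dv]; exact h
  · intro g rest done u L _ _ j _ i o _ h
    rw [Outcome.scale_g, Outcome.scale_done, Outcome.scale_dv]; exact h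
  · intro g rest done u L _ _ h hh i _ o _ h'
    rw [Outcome.scale_g, Outcome.scale_done, Outcome.scale_dv, h']
    conv_rhs => rw [← Multiset.cons_erase hh, Multiset.map_cons, Multiset.sum_cons]
    simp only [LGrp.absorb]
    ring
  · intro g rest done u L _ _ o _ h
    rw [Outcome.scale_g, Outcome.scale_done, Outcome.scale_dv]; exact h
  · intro g rest done u L _ _ o _ h
    rw [Outcome.push_g, Outcome.push_done, Outcome.push_dv]; exact h
  · intro g rest done u L _ _ m j o _ h
    rw [Outcome.bump_g, Outcome.bump_done, Outcome.bump_dv, Outcome.scale_g, Outcome.scale_done, Outcome.scale_dv, h]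
    simp only
    ring

/-! ## §2  The counts of a term are the sums over its components -/

variable {A f c legs obs M}

omit [Fintype S] [DecidableEq S] [Fintype ι] in
/-- (plumbing) the environment left by the run of the least observable is smaller. [folklore] -/
private theorem card_rest_lt {n : ℕ} {rest : Finset κ} (h : rest.Nonempty) (hn : rest.card < n + 1)
    {o : Outcome S κ} (ho : o.rest ⊆ rest.erase (rest.min' h)) : o.rest.card < n :=
  lt_of_lt_of_le (lt_of_le_of_lt (Finset.card_le_card ho) (Finset.card_erase_lt_of_mem (rest.min'_mem h)))
    (Nat.lt_succ_iff.1 hn)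

/-- **The `χ′`-directions of a term are those of its components**: `Σ_{consts + groups} nchi = Σ_{done} nchi + |dirs|`.
[cite: BalabanImbrieJaffe1988, §5.14 p.311–312] -/
theorem expand_nchi : ∀ (n : ℕ) (done : Multiset (LGrp S κ)) (rest : Finset κ), rest.card < n →
    ∀ t ∈ expand A f c legs obs M done rest,
      ((t.consts + t.groups).map fun h => h.nchi).sum = (done.map fun h => h.nchi).sum + t.dirs.length
  | 0, _, _, hn => fun _ _ => absurd hn (Nat.not_lt_zero _)
  | n + 1, done, rest, hn => by
    intro t ht
    by_cases h : rest.Nonempty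
    · rw [expand_of_nonempty A f c legs obs M h, mem_mbind] at ht
      obtain ⟨o, ho, ht⟩ := ht
      have hcard : o.rest.card < n := card_rest_lt h hn (run_rest_subset _ _ _ o ho)
      have hr := run_nchi A f c legs obs M _ _ _ o ho
      simp only [pristine, zero_add] at hr
      split_ifs at ht with hg
      · rw [Multiset.mem_map] at ht
        obtain ⟨t', ht', rfl⟩ := ht
        have ih := expand_nchi n o.done o.rest hcard t' ht'
        rw [RTerm.addConst_consts, oact_consts, RTerm.addConst_groups, oact_groups, RTerm.addConst_dirs, oact_dirs,
          Multiset.cons_add, Multiset.map_cons, Multiset.sum_cons, ih, List.length_append, ← add_assoc, hr]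
        ring
      · rw [Multiset.mem_map] at ht
        obtain ⟨t', ht', rfl⟩ := ht
        have ih := expand_nchi n (o.g ::ₘ o.done) o.rest hcard t' ht'
        rw [oact_consts, oact_groups, oact_dirs, ih, Multiset.map_cons, Multiset.sum_cons, hr, List.length_append]
        ring
    · rw [expand_of_not_nonempty A f c legs obs M h, Multiset.mem_singleton] at ht
      subst ht
      rw [zero_add, List.length_nil, add_zero]

/-- **The vertices of a term are those of its components**: `Σ_{consts + groups} nv = Σ_{done} nv + nv t`.
[cite: BalabanImbrieJaffe1988, §5.14 p.311–312] -/
theorem expand_nv : ∀ (n : ℕ) (done : Multiset (LGrp S κ)) (rest : Finset κ), rest.card < n →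
    ∀ t ∈ expand A f c legs obs M done rest,
      ((t.consts + t.groups).map fun h => h.nv).sum = (done.map fun h => h.nv).sum + t.nv
  | 0, _, _, hn => fun _ _ => absurd hn (Nat.not_lt_zero _)
  | n + 1, done, rest, hn => by
    intro t ht
    by_cases h : rest.Nonempty
    · rw [expand_of_nonempty A f c legs obs M h, mem_mbind] at ht
      obtain ⟨o, ho, ht⟩ := ht
      have hcard : o.rest.card < n := card_rest_lt h hn (run_rest_subset _ _ _ o ho)
      have hr := run_nv A f c legs obs M _ _ _ o ho
      simp only [pristine, zero_add] at hr
      split_ifs at ht with hg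
      · rw [Multiset.mem_map] at ht
        obtain ⟨t', ht', rfl⟩ := ht
        have ih := expand_nv n o.done o.rest hcard t' ht'
        rw [RTerm.addConst_consts, oact_consts, RTerm.addConst_groups, oact_groups, RTerm.addConst_nv, oact_nv,
          Multiset.cons_add, Multiset.map_cons, Multiset.sum_cons, ih, ← add_assoc, hr]
        ring
      · rw [Multiset.mem_map] at ht
        obtain ⟨t', ht', rfl⟩ := ht
        have ih := expand_nv n (o.g ::ₘ o.done) o.rest hcard t' ht'
        rw [oact_consts, oact_groups, oact_nv, ih, Multiset.map_cons, Multiset.sum_cons, hr]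
        ring
    · rw [expand_of_not_nonempty A f c legs obs M h, Multiset.mem_singleton] at ht
      subst ht
      rw [zero_add, add_zero]

/-- **Every set-aside component of a term is a remainder component** (*"The components containing contractions to
χ′ … or at least m̄+1 interactions are called remainder components"*): given that the components passed in are
complete and not constant, so is every member of `t.groups`, hence `0 < nchi ∨ M ≤ nv` for each.
[cite: BalabanImbrieJaffe1988, §5.14 p.311] -/
theorem expand_groups_isRem : ∀ (n : ℕ) (done : Multiset (LGrp S κ)) (rest : Finset κ), rest.card < n →
    (∀ h ∈ done, h.complete M = true) → (∀ h ∈ done, ¬ h.IsConst M) →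
    ∀ t ∈ expand A f c legs obs M done rest, ∀ g ∈ t.groups, g.IsRem M
  | 0, _, _, hn => fun _ _ _ _ => absurd hn (Nat.not_lt_zero _)
  | n + 1, done, rest, hn => by
    intro hc hk t ht
    by_cases h : rest.Nonempty
    · rw [expand_of_nonempty A f c legs obs M h, mem_mbind] at ht
      obtain ⟨o, ho, ht⟩ := ht
      have hcard : o.rest.card < n := card_rest_lt h hn (run_rest_subset _ _ _ o ho)
      have hdo : ∀ h ∈ o.done, h.complete M = true :=
        fun h hh => hc h (Multiset.mem_of_le (run_done_le _ _ _ o ho) hh)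
      have hko : ∀ h ∈ o.done, ¬ h.IsConst M :=
        fun h hh => hk h (Multiset.mem_of_le (run_done_le _ _ _ o ho) hh)
      split_ifs at ht with hg
      · rw [Multiset.mem_map] at ht
        obtain ⟨t', ht', rfl⟩ := ht
        rw [RTerm.addConst_groups, oact_groups]
        exact expand_groups_isRem n o.done o.rest hcard hdo hko t' ht'
      · rw [Multiset.mem_map] at ht
        obtain ⟨t', ht', rfl⟩ := ht
        rw [oact_groups]
        refine expand_groups_isRem n (o.g ::ₘ o.done) o.rest hcard ?_ ?_ t' ht'
        · intro h hh
          rcases Multiset.mem_cons.1 hh with rfl | hh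
          · exact run_complete _ _ _ o ho
          · exact hdo h hh
        · intro h hh
          rcases Multiset.mem_cons.1 hh with rfl | hh
          · exact hg
          · exact hko h hh
    · rw [expand_of_not_nonempty A f c legs obs M h, Multiset.mem_singleton] at ht
      subst ht
      intro g hg
      exact (Grp.isConst_or_isRem_of_complete (hc g hg)).resolve_left (hk g hg)

/-! ## §3  The count -/

/-- **EACH REMAINDER COMPONENT CARRIES ITS OWN SMALL-FACTOR SOURCE, COUNTED** (p. 311: remainder components are
*"The components containing contractions to χ′ …, or at least m̄ + 1 interactions"*, component by component): for every
term of
the labelled expansion of the observables `K` from nothing set aside, every set-aside component `X_r` is a remainder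
component (a contraction to `χ′` of its own, or at least `M` vertices of its own); the components with a `χ′` are at
most `|dirs t|` in number, `M` times the number of vertex-saturated ones is at most `nv t`, and every `X_r` is of
one of the two kinds. [cite: BalabanImbrieJaffe1988, §5.14 p.311–312] -/
theorem remainder_components_count (K : Finset κ) :
    ∀ t ∈ expand A f c legs obs M 0 K,
      (∀ g ∈ t.groups, g.IsRem M)
      ∧ Multiset.card (t.groups.filter fun g => 0 < g.nchi) ≤ t.dirs.length
      ∧ M * Multiset.card (t.groups.filter fun g => M ≤ g.nv) ≤ t.nv
      ∧ Multiset.card t.groups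
          ≤ Multiset.card (t.groups.filter fun g => 0 < g.nchi) + Multiset.card (t.groups.filter fun g => M ≤ g.nv) := by
  intro t ht
  have hrem : ∀ g ∈ t.groups, g.IsRem M := expand_groups_isRem _ 0 K (Nat.lt_succ_self _)
    (fun h hh => absurd hh (Multiset.notMem_zero _)) (fun h hh => absurd hh (Multiset.notMem_zero _)) t ht
  have hchi := expand_nchi (A := A) (f := f) (c := c) (legs := legs) (obs := obs) (M := M) _ 0 K
    (Nat.lt_succ_self _) t ht
  have hnv := expand_nv (A := A) (f := f) (c := c) (legs := legs) (obs := obs) (M := M) _ 0 K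
    (Nat.lt_succ_self _) t ht
  rw [Multiset.map_zero, Multiset.sum_zero, zero_add, Multiset.map_add, Multiset.sum_add] at hchi hnv
  refine ⟨hrem, ?_, ?_, ?_⟩
  · -- each component with a `χ′` has `nchi ≥ 1`
    have h1 : Multiset.card ((t.groups.filter fun g => 0 < g.nchi).map fun h => h.nchi) • 1
        ≤ ((t.groups.filter fun g => 0 < g.nchi).map fun h => h.nchi).sum :=
      Multiset.card_nsmul_le_sum fun x hx => by
        obtain ⟨g, hg, rfl⟩ := Multiset.mem_map.1 hx
        exact (Multiset.mem_filter.1 hg).2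
    rw [Multiset.card_map, smul_eq_mul, mul_one] at h1
    have h2 : ((t.groups.filter fun g => 0 < g.nchi).map fun h => h.nchi).sum
        ≤ (t.groups.map fun h => h.nchi).sum := by
      conv_rhs => rw [← Multiset.filter_add_not (fun g : LGrp S κ => 0 < g.nchi) t.groups, Multiset.map_add,
        Multiset.sum_add]
      exact Nat.le_add_right _ _
    omega
  · have h1 : Multiset.card ((t.groups.filter fun g => M ≤ g.nv).map fun h => h.nv) • M
        ≤ ((t.groups.filter fun g => M ≤ g.nv).map fun h => h.nv).sum :=
      Multiset.card_nsmul_le_sum fun x hx => by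
        obtain ⟨g, hg, rfl⟩ := Multiset.mem_map.1 hx
        exact (Multiset.mem_filter.1 hg).2
    rw [Multiset.card_map, smul_eq_mul, mul_comm] at h1
    have h2 : ((t.groups.filter fun g => M ≤ g.nv).map fun h => h.nv).sum ≤ (t.groups.map fun h => h.nv).sum := by
      conv_rhs => rw [← Multiset.filter_add_not (fun g : LGrp S κ => M ≤ g.nv) t.groups, Multiset.map_add,
        Multiset.sum_add]
      exact Nat.le_add_right _ _
    omega
  · have h1 : t.groups.filter (fun g => ¬ 0 < g.nchi) ≤ t.groups.filter fun g => M ≤ g.nv :=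
      Multiset.le_filter.2 ⟨Multiset.filter_le _ _, fun g hg =>
        ((hrem g (Multiset.mem_filter.1 hg).1).resolve_left (Multiset.mem_filter.1 hg).2)⟩
    conv_lhs => rw [← Multiset.filter_add_not (fun g : LGrp S κ => 0 < g.nchi) t.groups]
    rw [Multiset.card_add]
    exact Nat.add_le_add_left (Multiset.card_le_card h1) _

end Literature.MathematicalPhysics.QuantumFieldTheory.BalabanImbrieJaffe1984to88.BIJ88LabelledRemainderCount312

end
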